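import Literature.Algebra.Homology.TateNakayamaCupProduct
import Literature.Algebra.Homology.GroupCohomologyRestrictionCorestriction
import HarnessLib

/-!
# Inflation of Tate–Nakayama classes: `Inf(u₂ ∪ x) = Inf u₂ ∪ Inf x = m·(u₁ ∪ Inf x)`, and the
# vanishing of `H^{n+2}(G₂, C₂ ⊗ N) → H^{n+2}(G₁, C₁ ⊗ N)` for `|G₂| ∣ m` (Milne I Lemma 1.9 engine)

Topic `Algebra/Homology`; namespace `Literature.Algebra.Homology`.  Theorems only (no definition, no
named fact, no instance).  Sequel of `TateNakayamaCupProduct` (door-c6 g11: the Tate–Nakayama map in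
degrees `≥ 1` IS `x ↦ res_U[φ] ∪ x`, bijective for class modules) and of
`GroupCohomologyCupProductCoefficientsCommutative` (Brown V (3.7) with coefficients, `map_res_cupProductRep`).

For a group homomorphism `π : G₁ → G₂` (intended: a surjection `Γ/V ↠ Γ/U` between finite layers of a
profinite group), representations `C₂, N` of `G₂`, `C₁` of `G₁` and a `G₁`-map `ι : Res_π C₂ → C₁`
(intended: the inclusion `C^U ↪ C^V` of a formation module):

* §1 `card_smul_eq_zero_groupCohomology_succ` — `|G| · Hⁿ⁺¹(G, A) = 0` (`G` finite, any `k`, any `A`);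
  restriction to `⊤` is bijective on cohomology (transport along `⊤ ≃ G`, private).
* §2 **`map_cupProductRep_eq`** — `Inf_π(u ∪ x) = (Inf_π u) ∪ (Inf_π x)` in `H^{p+q}(G₁, C₁ ⊗ Res_π N)`,
  `Inf_π = groupCohomology.map π (·)` along `ι` on the first factor and the identity on the second
  (Brown (3.7)/(3.2) on cochains: `(ι ⊗ 1)((f ∪ g) ∘ π) = (ι ∘ f ∘ π) ∪ (g ∘ π)`);
  **`map_cupProductRep_H2π_eq_nsmul`** — if `Inf_π[φ₂] = d·[φ₁]` (tower axiom of a class formation,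
  `Inf u_{G/U} = (U:V)·u_{G/V}`; the tree's `Deflation.H2π_normCocycle`) then
  `Inf_π([φ₂] ∪ x) = [φ₁] ∪ (d · Inf_π x)`.
* §3 **`map_cupProductRep_H2π_eq_zero_of_dvd`** — if moreover `|G₂| ∣ d` then `Inf_π([φ₂] ∪ x) = 0` for
  `x ∈ Hⁿ⁺¹(G₂, N)` (`|G₂|` kills `Hⁿ⁺¹(G₂, N)`).
* §4 for a CLASS MODULE `C` of the finite group `G` (over `ℤ`) and torsion-free `N`:
  **`IsClassModule.cupProductRep_self_bijective`** — the SELF form (`U = G`) of the Tate–Nakayama cup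
  isomorphism, `x ↦ [φ] ∪ x : Hⁿ(G, N) → Hⁿ⁺²(G, C ⊗ N)` bijective for `n ≥ 1` (from the `Res_⊤` form of
  `TateNakayamaCupProduct`); **`IsClassModule.map_eq_zero_of_card_dvd`** — EVERY class of
  `Hⁿ⁺³(G, C ⊗ N)` dies under an inflation `Inf_π` with `Inf_π[φ] = d·[φ₁]`, `|G| ∣ d`.

USE (Milne *ADT* I Lemma 1.9 / Harari Lemma 16.20 for a profinite class formation `(Γ, C)`): for a
`Γ/U₀`-lattice `N`, `Ext^r_Γ(N^∨… )`/`H^r(Γ, N ⊗ C) = colim_U H^r(Γ/U, N ⊗ C^U)` VANISHES for `r ≥ 3`: given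
a class at level `U`, pick `V ≤ U` open with `|Γ/U| ∣ (U:V)` (unramified/cyclotomic layers; on `ℓ`-parts
for a `P`-class formation) and apply §3 to `π : Γ/V ↠ Γ/U`, `m = (U:V)`.  Route A to Poitou–Tate, cell
bsd-schneider-ideate (FINDING-door-c6-g10 §2, FINDING-door-c6-g11-allplaces (A5)).

## References
* J. S. Milne, *Arithmetic Duality Theorems* (2006), I Lemma 1.9 (proof: "the maps `(U:V)·Inf` …
  kill `Ĥ^{r−2}` in the limit"). [MilneADT2006]
* D. Harari, *Galois Cohomology and Class Field Theory* (2020), Lemma 16.20, Prop. 16.4 (b)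
  (`Inf u_{G/U} = (U:V) u_{G/V}`), Thm. 3.14. [Harari2020]
* K. S. Brown, *Cohomology of Groups* (1982), V §3 (3.2), (3.7); III Cor. 10.2. [Brown1982CohomologyGroups]
-/

noncomputable section

open CategoryTheory CategoryTheory.Limits MonoidalCategory groupCohomology
open scoped TensorProduct

universe u

namespace Literature.Algebra.Homology

open SplittingModule

/-! ## §1 `|G|` kills `Hⁿ⁺¹(G, A)`; the self form of the Tate–Nakayama cup isomorphism -/

section Self

variable {k G : Type u} [CommRing k] [Group G]

/-- **`|G| · x = 0` for every `x ∈ Hⁿ⁺¹(G, A)`**, `G` finite, any coefficient ring and module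
(`cor ∘ res = (G : 1)` through the trivial subgroup, Brown III Cor. 10.2; the tree's
`index_smul_eq_zero_of_isZero_subgroup`). [cite: Brown1982CohomologyGroups, III Cor. 10.2 (p. 84)] -/
theorem card_smul_eq_zero_groupCohomology_succ [Finite G] (A : Rep.{u} k G) (n : ℕ)
    (x : groupCohomology A (n + 1)) : Nat.card G • x = 0 := by
  haveI : (⊥ : Subgroup G).FiniteIndex := Subgroup.finiteIndex_of_finite_quotient
  rw [← Subgroup.index_bot]
  exact index_smul_eq_zero_of_isZero_subgroup (⊥ : Subgroup G) A (n + 1)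
    (isZero_groupCohomology_succ_of_subsingleton _ n) x

/-- **Restriction to the subgroup `⊤` is bijective on cohomology** (`⊤ ≃ G`; Mathlib's
`groupCohomology.mapIso` along `Subgroup.topEquiv`, identity on vectors). [folklore] -/
private theorem map_top_subtype_bijective (A : Rep.{u} k G) (n : ℕ) :
    Function.Bijective (fun x : groupCohomology A n =>
      map (⊤ : Subgroup G).subtype (𝟙 (Rep.res (⊤ : Subgroup G).subtype A)) n x) :=
  ConcreteCategory.bijective_of_isIso
    (mapIso (Subgroup.topEquiv : (⊤ : Subgroup G) ≃* G).symm
      (A := Rep.res (⊤ : Subgroup G).subtype A) (B := A) (LinearEquiv.refl k A.V) (fun _ => rfl) n).hom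

/-- Restriction to `⊤` followed by `Res_⊤(C ⊗ N) = Res_⊤ C ⊗ Res_⊤ N` (the identity on vectors,
`resTensorHom`) is bijective on cohomology. [folklore] -/
private theorem map_top_subtype_resTensorHom_bijective (C N : Rep.{u} k G) (n : ℕ) :
    Function.Bijective (fun x : groupCohomology (C ⊗ N) n =>
      map (⊤ : Subgroup G).subtype (resTensorHom C N (⊤ : Subgroup G).subtype) n x) :=
  map_top_subtype_bijective (C ⊗ N) n

end Self

/-! ## §2 Inflation of cup products with a restricted first factor -/

section Inflation

variable {k : Type u} [CommRing k] {G₁ G₂ : Type u} [Group G₁] [Group G₂] (π : G₁ →* G₂)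
  {C₂ N : Rep.{u} k G₂} {C₁ : Rep.{u} k G₁} (ι : Rep.res π C₂ ⟶ C₁) {p q m : ℕ}

/-- `cochainsMap π φ` on cochains is `x ↦ φ ∘ x ∘ πⁿ`. [cite: Brown1982CohomologyGroups, III §8] -/
private theorem cochainsMap_f_apply' {A : Rep.{u} k G₂} {B : Rep.{u} k G₁} (φ : Rep.res π A ⟶ B) (n : ℕ)
    (x : (Fin n → G₂) → A) (g : Fin n → G₁) : (cochainsMap π φ).f n x g = φ.hom (x (π ∘ g)) := by
  rw [cochainsMap_f]
  rfl

/-- **`Inf_π(u ∪ x) = Inf_π u ∪ Inf_π x`** (Brown (3.7) + (3.2)): for `π : G₁ → G₂`, a `G₁`-map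
`ι : Res_π C₂ → C₁`, `u ∈ Hᵖ(G₂, C₂)`, `x ∈ H^q(G₂, N)`, the pull-back of `u ∪ x` along `π` and the
coefficient map `Res_π(C₂ ⊗ N) = Res_π C₂ ⊗ Res_π N → C₁ ⊗ Res_π N` is `(map π ι u) ∪ (map π 𝟙 x)`
(on cochains: `(ι ⊗ 1)((f ∪ g)(π ∘ ·)) = (ι ∘ f ∘ π) ∪ (g ∘ π)`, the twist being carried by `π`).
[cite: Brown1982CohomologyGroups, V §3 (3.7) and (3.2)] -/
theorem map_cupProductRep_eq (h : p + q = m) (u : groupCohomology C₂ p) (x : groupCohomology N q) :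
    map π (resTensorHom C₂ N π ≫ (ι ⊗ₘ 𝟙 (Rep.res π N))) m (cupProductRep C₂ N h u x) =
      cupProductRep C₁ (Rep.res π N) h (map π ι p u) (map π (𝟙 (Rep.res π N)) q x) := by
  induction u using groupCohomology_induction_on with
  | h z₁ =>
    induction x using groupCohomology_induction_on with
    | h z₂ =>
      rw [cupProductRep_π_π, π_map_apply, π_map_apply, π_map_apply, cupProductRep_π_π]
      congr 1
      apply iCocycles_injective (C₁ ⊗ Rep.res π N) m
      rw [iCocycles_cocyclesMap_eq, iCocycles_cocyclesCupRep, iCocycles_cocyclesCupRep,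
        iCocycles_cocyclesMap_eq, iCocycles_cocyclesMap_eq]
      funext g
      rw [cochainsMap_f_apply', Rep.hom_comp, Representation.IntertwiningMap.comp_apply,
        resTensorHom_hom_apply, cupCochainRep_comp, tensorHom_comp_cupCochainRep]
      exact congrArg₂ (fun a b => cupCochainRep C₁ (Rep.res π N) h a b g)
        (funext fun y => (cochainsMap_f_apply' π ι p _ y).symm)
        (funext fun y => (cochainsMap_f_apply' π (𝟙 (Rep.res π N)) q _ y).symm)

/-- **`Inf_π([φ₂] ∪ x) = [φ₁] ∪ (m · Inf_π x)` under the tower axiom `Inf_π[φ₂] = m·[φ₁]`** (for a class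
formation: `Inf u_{G/U} = (U:V)·u_{G/V}`, Harari Prop. 16.4 (b)). [cite: Harari2020, Prop. 16.4 (b)]
[cite: Brown1982CohomologyGroups, V §3 (3.7)] -/
theorem map_cupProductRep_H2π_eq_nsmul (φ₂ : cocycles₂ C₂) (φ₁ : cocycles₂ C₁) {d : ℕ}
    (hι : map π ι 2 (H2π C₂ φ₂) = d • H2π C₁ φ₁) (h : 2 + q = m) (x : groupCohomology N q) :
    map π (resTensorHom C₂ N π ≫ (ι ⊗ₘ 𝟙 (Rep.res π N))) m (cupProductRep C₂ N h (H2π C₂ φ₂) x) =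
      cupProductRep C₁ (Rep.res π N) h (H2π C₁ φ₁) (d • map π (𝟙 (Rep.res π N)) q x) := by
  rw [map_cupProductRep_eq, hι, map_nsmul, LinearMap.smul_apply, map_nsmul]

/-! ## §3 Vanishing: `|G₂| ∣ m` kills the inflation of every Tate–Nakayama class -/

/-- **`Inf_π([φ₂] ∪ x) = 0` when `Inf_π[φ₂] = m·[φ₁]` with `|G₂| ∣ m`**, for `x ∈ Hⁿ⁺¹(G₂, N)` (`G₂` finite:
`|G₂|` kills `Hⁿ⁺¹(G₂, N)`).  This is the mechanism of Milne I Lemma 1.9: in the tower of a class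
formation the transition maps `(U:V)·Inf` kill `Ĥ^{r−2}(G/U, N)` as soon as `|G/U| ∣ (U:V)`.
[cite: MilneADT2006, Ch. I, Lemma 1.9 (proof)] [cite: Harari2020, Lemma 16.20] -/
theorem map_cupProductRep_H2π_eq_zero_of_dvd [Finite G₂] (φ₂ : cocycles₂ C₂) (φ₁ : cocycles₂ C₁) {d : ℕ}
    (hι : map π ι 2 (H2π C₂ φ₂) = d • H2π C₁ φ₁) (hd : Nat.card G₂ ∣ d) {n : ℕ} (h : 2 + (n + 1) = m)
    (x : groupCohomology N (n + 1)) :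
    map π (resTensorHom C₂ N π ≫ (ι ⊗ₘ 𝟙 (Rep.res π N))) m (cupProductRep C₂ N h (H2π C₂ φ₂) x) = 0 := by
  rw [map_cupProductRep_H2π_eq_nsmul π ι φ₂ φ₁ hι h x, ← map_nsmul]
  obtain ⟨e, rfl⟩ := hd
  rw [mul_nsmul, card_smul_eq_zero_groupCohomology_succ N n x, smul_zero, map_zero, map_zero]

end Inflation

/-! ## §4 Class modules: every class of `Hⁿ⁺²(G₂, C₂ ⊗ N)` dies under such an inflation -/

section ClassModule

variable {G : Type} [Group G] [Fintype G] {C : Rep.{0} ℤ G} {φ : cocycles₂ C}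

/-- Transport of the subgroup form along `⊤ ≃ G`: **`x ↦ [φ] ∪ x : Hⁿ(G, N) → Hⁿ⁺²(G, C ⊗ N)` is
bijective** for a class module `C` (over `ℤ`, `G` finite), torsion-free `N` and `n ≥ 1` — the Tate–Nakayama
isomorphism as the printed cup product, for `G` itself (Harari Thm. 3.14 with `H = G`).
[cite: Harari2020, Thm. 3.14] -/
theorem IsClassModule.cupProductRep_self_bijective (hC : IsClassModule C φ) (N : Rep.{0} ℤ G)
    [IsAddTorsionFree N.V] (n : ℕ) [NeZero n] :
    Function.Bijective (fun x : groupCohomology N n =>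
      cupProductRep C N (Nat.add_comm 2 n) (H2π C φ) x) := by
  -- `res_⊤ ∘ ([φ] ∪ ·) = (res_⊤[φ] ∪ ·) ∘ res_⊤` (Brown (3.7)), with both `res_⊤` bijective
  have hsq : (fun y : groupCohomology (C ⊗ N) (n + 2) =>
        map (⊤ : Subgroup G).subtype (resTensorHom C N (⊤ : Subgroup G).subtype) (n + 2) y) ∘
      (fun x : groupCohomology N n => cupProductRep C N (Nat.add_comm 2 n) (H2π C φ) x) =
      (fun x => cupProductRep (Rep.res (⊤ : Subgroup G).subtype C) (Rep.res (⊤ : Subgroup G).subtype N)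
          (Nat.add_comm 2 n) (map (⊤ : Subgroup G).subtype (𝟙 _) 2 (H2π C φ)) x) ∘
        (fun x : groupCohomology N n =>
          map (⊤ : Subgroup G).subtype (𝟙 (Rep.res (⊤ : Subgroup G).subtype N)) n x) :=
    funext fun x => map_res_cupProductRep C N (⊤ : Subgroup G).subtype (Nat.add_comm 2 n) (H2π C φ) x
  have hbij := (hC.cupProductRep_H2π_bijective N (⊤ : Subgroup G) n).comp (map_top_subtype_bijective N n)
  rw [← hsq] at hbij
  exact (Function.Bijective.of_comp_iff' (map_top_subtype_resTensorHom_bijective C N (n + 2)) _).1 hbij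

variable {G₁ : Type} [Group G₁] (π : G₁ →* G) {C₁ : Rep.{0} ℤ G₁} (ι : Rep.res π C ⟶ C₁)

/-- **Milne I Lemma 1.9, finite-layer engine: EVERY class of `Hⁿ⁺³(G, C ⊗ N)` dies under an inflation
`Inf_π` with `Inf_π[φ] = d·[φ₁]`, `|G| ∣ d`.**  For a class module `C` of the finite group `G` with
fundamental class `[φ]`, a torsion-free `N`, a homomorphism `π : G₁ → G` (a deeper layer `Γ/V ↠ Γ/U`),
a `G₁`-module `C₁` with a `2`-cocycle `φ₁` and a `G₁`-map `ι : Res_π C → C₁` such that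
`Inf_π[φ] = d·[φ₁]` (class-formation tower `Inf u_U = (U:V) u_V`) and `|G| ∣ d`: the map
`Hⁿ⁺³(G, C ⊗ N) → Hⁿ⁺³(G₁, C₁ ⊗ Res_π N)` vanishes identically (every class is `[φ] ∪ x`, `x ∈ Hⁿ⁺¹(G, N)`,
by the Tate–Nakayama cup isomorphism, and `Inf_π([φ] ∪ x) = [φ₁] ∪ (d · Inf x) = 0`).  Hence
`colim_U H^r(Γ/U, C^U ⊗ N) = 0` for `r ≥ 3` along any tower with unbounded indices.
[cite: MilneADT2006, Ch. I, Lemma 1.9] [cite: Harari2020, Lemma 16.20] -/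
theorem IsClassModule.map_eq_zero_of_card_dvd (hC : IsClassModule C φ) (N : Rep.{0} ℤ G)
    [IsAddTorsionFree N.V] (φ₁ : cocycles₂ C₁) {d : ℕ} (hι : map π ι 2 (H2π C φ) = d • H2π C₁ φ₁)
    (hd : Nat.card G ∣ d) (n : ℕ) (y : groupCohomology (C ⊗ N) (n + 3)) :
    map π (resTensorHom C N π ≫ (ι ⊗ₘ 𝟙 (Rep.res π N))) (n + 3) y = 0 := by
  obtain ⟨x, rfl⟩ := (hC.cupProductRep_self_bijective N (n + 1)).2 y
  exact map_cupProductRep_H2π_eq_zero_of_dvd π ι φ φ₁ hι hd (by omega) x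

end ClassModule

end Literature.Algebra.Homology

end
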